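import Mathlib
import Summits.Ventures.PercRepro2.HCov
import Summits.Ventures.PercRepro2.DiagBA3
import Summits.Ventures.PercRepro2.A3RootEdge
import Summits.Ventures.PercRepro2.RootEdgeBern
import Summits.Ventures.PercRepro2.HCovPlusQuartic
import Summits.Ventures.PercRepro2.QuarticRootCross
import Summits.Ventures.PercRepro2.QuarticRootCrossOL
import Summits.Ventures.PercRepro2.QuarticRootSlack
import Summits.Ventures.PercRepro2.QuarticRootSlackSign
import Summits.Ventures.PercRepro2.QuarticRootSplit
import Summits.Ventures.PercRepro2.QuarticRootSigned

/-!
# THE ROOT-EDGE FACE FROM THE KERNEL ALONE — THE TYPED TARGET (W): `NEG ≤ Q₁²·Gc₀`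
(blind cell PercRepro2, p5 g20; `proofs/P5-OEDGE.md` §26 addendum 2, `proofs/subclaims/S4-HARDSTEP.md` v90)

The signed form of the root-edge face (`QuarticRootSigned.Q0_mul_H2_root_signed`) is
`Q₀·H2 = 2D₀Q₀²g₁ + [Q₁²·Gc₀ + Q₀·A·slackBm + 2Q₁·df·δ_oL^T] − NEG`, `NEG = 2δ_oH·[Q₀·δ_bH + Q₁·(G1 + G2)]`.
The two explicit payers are theorems: `A = D₀β + δ′_oL ≥ 0`, `slackBm = 2(G1 + G2 + G3 + G4) ≥ 0`,
`df = G1 + G2 + Q₀·p3 ≥ 0` ((I7)), `δ_oL^T ≥ 0`. Hence the single closed-pin statement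

  **(W)**  `NEG ≤ Q₁²·Gc₀`  — «the kernel at the closed pin alone covers the product term»,
           in single-instance words `(D + t′)²·Gc ≥ 2δ_oH·[Q·δ_bH + (D + t′)·(G1 + G2)]`, a quantitative (HCOV)
           (its `δ_bH`-piece is p5 g19's (E4), census-clean on 20.7 M lines),

gives `0 ≤ H2` by itself: **`H2_nonneg_root_of_kernel_dominates`**. NO SIGN IS CLAIMED for (W): it is a census-true
candidate (p5 g20: 0 negatives on 1,702 random / `c < 0` / `KW < 0` / K-monotonicity-witness lines and on 14,418 lines of
two local ES runs, the relative margin driven to 1.2·10⁻⁴ at the weight-box boundary without crossing; kit j295650 under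
the ES adversary). Unlike the world-by-world pieces (TT) / (PT′) of `QuarticRootTwoPieces`, (W) does not split the
kernel — it compares the WHOLE closed-pin kernel with the product term.
-/

namespace Summit.Ventures.PercRepro2

open UnionCluster CovForm CovForm.EdgeLine CovForm.RootEdge CovForm.A3Fibre HCovPlusQuartic

namespace QuarticRootCross

section KernelDominates

variable {V : Type*} {E : Type*} [Fintype V] [DecidableEq V] [Fintype E] [DecidableEq E]
  {R : Type*} [Field R] [LinearOrder R] [IsStrictOrderedRing R]

variable {ends : E → Sym2 V} {e : E} {a₁ a₃ : V}

/-- **The two explicit payers of the signed form are non-negative**: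
`0 ≤ Q₀·A·slackBm + 2Q₁·df·δ_oL^T` (`A = D₀β + δ′_oL`, `slackBm = 2(G1 + G2 + G3 + G4)`, `df = G1 + G2 + Q₀p3`
by `df_eq_root`, `δ_oL^T ≥ 0` by `ToL_mul_D_le`). -/
theorem payers_nonneg_root (p : E → R) (hp : IsProbVec p) (hends : ends e = s(a₁, a₃)) (o a₂ b : V) :
    0 ≤ prob (Function.update p e 0) (avoidAll ends a₂ {a₁}) * (prob (Function.update p e 0) (PDEvent ends a₁ a₂ a₃) * prob (Function.update p e 0) (PDEvent ends a₁ a₂ a₃ ∩ connEvent ends a₃ o) + (prob (Function.update p e 0) (PDEvent ends a₁ a₂ a₃) * prob (Function.update p e 0) (TEvent ends a₂ a₁ a₃ ∩ connEvent ends a₁ o) - prob (Function.update p e 0) (PDEvent ends a₁ a₂ a₃ ∩ connEvent ends a₁ o) * prob (Function.update p e 0) (TEvent ends a₂ a₁ a₃))) * (2 * ((prob (Function.update p e 0) (TEvent ends a₁ a₂ a₃ ∩ connEvent ends a₂ b) * (prob (Function.update p e 0) (PDEvent ends a₁ a₂ a₃) + prob (Function.update p e 0) (TEvent ends a₂ a₁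 a₃)) - prob (Function.update p e 0) (TEvent ends a₁ a₂ a₃) * (prob (Function.update p e 0) (PDEvent ends a₁ a₂ a₃ ∩ connEvent ends a₂ b) + prob (Function.update p e 0) (TEvent ends a₂ a₁ a₃ ∩ connEvent ends a₂ b))) + (prob (Function.update p e 0) (TEvent ends a₁ a₂ a₃) * (prob (Function.update p e 0) (PDEvent ends a₁ a₂ a₃ ∩ connEvent ends a₁ b) + prob (Function.update p e 0) (TEvent ends a₂ a₁ a₃ ∩ connEvent ends a₁ b)) - prob (Function.update p e 0) (TEvent ends a₁ a₂ a₃ ∩ connEvent ends a₁ b) * (prob (Function.update p e 0) (PDEvent ends a₁ a₂ a₃) + prob (Function.update p e 0) (TEvent ends a₂ a₁ a₃))) + (prob (Function.update p e 0) (TEvent ends a₂ a₁ a₃) * prob (Function.update p e 0) (PDEvent ends a₁ a₂ a₃ ∩ connEvent ends a₂ b) - prob (Function.update p e 0) (PDEvent ends a₁ a₂ a₃) * prob (Function.update p e 0) (TEvent ends a₂ a₁ a₃ ∩ connEvent ends a₂ b)) + (prob (Function.update p e 0) (TEvent ends a₁ a₂ a₃) * prob (Function.update p e 0) (PDEvent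 ends a₁ a₂ a₃ ∩ connEvent ends a₃ b)))) + 2 * prob (Function.update p e 1) (avoidAll ends a₂ {a₁}) * (prob (Function.update p e 0) (avoidAll ends a₂ {a₁}) * (prob (Function.update p e 1) (avoidAll ends a₂ {a₁} ∩ connEvent ends a₁ b) - prob (Function.update p e 1) (avoidAll ends a₂ {a₁} ∩ connEvent ends a₂ b)) - prob (Function.update p e 1) (avoidAll ends a₂ {a₁}) * (prob (Function.update p e 0) (avoidAll ends a₂ {a₁} ∩ connEvent ends a₁ b) - prob (Function.update p e 0) (avoidAll ends a₂ {a₁} ∩ connEvent ends a₂ b))) * (prob (Function.update p e 0) (PDEvent ends a₁ a₂ a₃ ∩ connEvent ends a₁ o) * prob (Function.update p e 0) (TEvent ends a₁ a₂ a₃) - prob (Function.update p e 0) (PDEvent ends a₁ a₂ a₃) * prob (Function.update p e 0) (TEvent ends a₁ a₂ a₃ ∩ connEvent ends a₁ o)) := by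
  have hp₀ : IsProbVec (Function.update p e 0) := hp.update e le_rfl zero_le_one
  have hp₁ : IsProbVec (Function.update p e 1) := hp.update e zero_le_one le_rfl
  have hQ0 := prob_nonneg hp₀ (avoidAll ends a₂ {a₁})
  have hQ1 := prob_nonneg hp₁ (avoidAll ends a₂ {a₁})
  have hd := prob_nonneg hp₀ (PDEvent ends a₁ a₂ a₃)
  have ht := prob_nonneg hp₀ (TEvent ends a₁ a₂ a₃)
  have htp := prob_nonneg hp₀ (TEvent ends a₂ a₁ a₃)
  have hPDo3 := prob_nonneg hp₀ (PDEvent ends a₁ a₂ a₃ ∩ connEvent ends a₃ o)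
  have hPDb3 := prob_nonneg hp₀ (PDEvent ends a₁ a₂ a₃ ∩ connEvent ends a₃ b)
  -- δ′_oL ≥ 0
  have hoL := PDoL_mul_T'_le (Function.update p e 0) hp₀ ends o a₁ a₂ a₃
  -- δ_oL^T ≥ 0
  have hoLT := ToL_mul_D_le (Function.update p e 0) hp₀ ends o a₁ a₂ a₃
  -- δ_bH = G3 ≥ 0
  have hbH := DiagBA3.T'oH_mul_D_le (Function.update p e 0) hp₀ ends b a₁ a₂ a₃
  -- G1 ≥ 0
  have G1 := QbH_mul_T_le (Function.update p e 0) hp₀ ends a₁ a₂ a₃ b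
  rw [Qsplit_univ (Function.update p e 0) ends a₁ a₂ a₃,
    Qsplit (Function.update p e 0) ends a₁ a₂ a₃ (connEvent ends a₂ b)] at G1
  -- G2 ≥ 0
  have G2 := A3Inactive.bLoH_mul_Q_le (Function.update p e 0) hp₀ ends a₃ a₁ a₂ b
  rw [Q_inter_conn_a2_a3_inter ends a₁ a₂ a₃ (connEvent ends a₁ b),
    Qsplit_univ (Function.update p e 0) ends a₁ a₂ a₃,
    Qsplit (Function.update p e 0) ends a₁ a₂ a₃ (connEvent ends a₁ b)] at G2
  have eT : avoidAll ends a₂ {a₁} ∩ connEvent ends a₂ a₃ = TEvent ends a₁ a₂ a₃ := by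
    rw [TEvent, avoidAll_eq_compl]
  rw [eT] at G2
  have h1 : 0 ≤ (prob (Function.update p e 0) (TEvent ends a₁ a₂ a₃ ∩ connEvent ends a₂ b) * (prob (Function.update p e 0) (PDEvent ends a₁ a₂ a₃) + prob (Function.update p e 0) (TEvent ends a₂ a₁ a₃)) - prob (Function.update p e 0) (TEvent ends a₁ a₂ a₃) * (prob (Function.update p e 0) (PDEvent ends a₁ a₂ a₃ ∩ connEvent ends a₂ b) + prob (Function.update p e 0) (TEvent ends a₂ a₁ a₃ ∩ connEvent ends a₂ b))) := by linarith [G1]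
  have h2 : 0 ≤ (prob (Function.update p e 0) (TEvent ends a₁ a₂ a₃) * (prob (Function.update p e 0) (PDEvent ends a₁ a₂ a₃ ∩ connEvent ends a₁ b) + prob (Function.update p e 0) (TEvent ends a₂ a₁ a₃ ∩ connEvent ends a₁ b)) - prob (Function.update p e 0) (TEvent ends a₁ a₂ a₃ ∩ connEvent ends a₁ b) * (prob (Function.update p e 0) (PDEvent ends a₁ a₂ a₃) + prob (Function.update p e 0) (TEvent ends a₂ a₁ a₃))) := by linarith [G2]
  have h3 : 0 ≤ (prob (Function.update p e 0) (TEvent ends a₂ a₁ a₃) * prob (Function.update p e 0) (PDEvent ends a₁ a₂ a₃ ∩ connEvent ends a₂ b) - prob (Function.update p e 0) (PDEvent ends a₁ a₂ a₃) * prob (Function.update p e 0) (TEvent ends a₂ a₁ a₃ ∩ connEvent ends a₂ b)) := by linarith [hbH]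
  have h4 : 0 ≤ (prob (Function.update p e 0) (TEvent ends a₁ a₂ a₃) * prob (Function.update p e 0) (PDEvent ends a₁ a₂ a₃ ∩ connEvent ends a₃ b)) := mul_nonneg ht hPDb3
  have hslm : 0 ≤ (2 * ((prob (Function.update p e 0) (TEvent ends a₁ a₂ a₃ ∩ connEvent ends a₂ b) * (prob (Function.update p e 0) (PDEvent ends a₁ a₂ a₃) + prob (Function.update p e 0) (TEvent ends a₂ a₁ a₃)) - prob (Function.update p e 0) (TEvent ends a₁ a₂ a₃) * (prob (Function.update p e 0) (PDEvent ends a₁ a₂ a₃ ∩ connEvent ends a₂ b) + prob (Function.update p e 0) (TEvent ends a₂ a₁ a₃ ∩ connEvent ends a₂ b))) + (prob (Function.update p e 0) (TEvent ends a₁ a₂ a₃) * (prob (Function.update p e 0) (PDEvent ends a₁ a₂ a₃ ∩ connEvent ends a₁ b) + prob (Function.update p e 0) (TEvent ends a₂ a₁ a₃ ∩ connEvent ends a₁ b)) - prob (Function.update p e 0) (TEvent ends a₁ a₂ a₃ ∩ connEvent ends a₁ b) * (prob (Function.update p e 0) (PDEvent ends a₁ a₂ a₃) + prob (Function.update p e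 0) (TEvent ends a₂ a₁ a₃))) + (prob (Function.update p e 0) (TEvent ends a₂ a₁ a₃) * prob (Function.update p e 0) (PDEvent ends a₁ a₂ a₃ ∩ connEvent ends a₂ b) - prob (Function.update p e 0) (PDEvent ends a₁ a₂ a₃) * prob (Function.update p e 0) (TEvent ends a₂ a₁ a₃ ∩ connEvent ends a₂ b)) + (prob (Function.update p e 0) (TEvent ends a₁ a₂ a₃) * prob (Function.update p e 0) (PDEvent ends a₁ a₂ a₃ ∩ connEvent ends a₃ b)))) := by
    have := add_nonneg (add_nonneg (add_nonneg h1 h2) h3) h4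
    linarith [this]
  have hdL : 0 ≤ (prob (Function.update p e 0) (PDEvent ends a₁ a₂ a₃) * prob (Function.update p e 0) (TEvent ends a₂ a₁ a₃ ∩ connEvent ends a₁ o) - prob (Function.update p e 0) (PDEvent ends a₁ a₂ a₃ ∩ connEvent ends a₁ o) * prob (Function.update p e 0) (TEvent ends a₂ a₁ a₃)) := by linarith [hoL]
  have hA : 0 ≤ prob (Function.update p e 0) (PDEvent ends a₁ a₂ a₃) * prob (Function.update p e 0) (PDEvent ends a₁ a₂ a₃ ∩ connEvent ends a₃ o) + (prob (Function.update p e 0) (PDEvent ends a₁ a₂ a₃) * prob (Function.update p e 0) (TEvent ends a₂ a₁ a₃ ∩ connEvent ends a₁ o) - prob (Function.update p e 0) (PDEvent ends a₁ a₂ a₃ ∩ connEvent ends a₁ o) * prob (Function.update p e 0) (TEvent ends a₂ a₁ a₃)) := add_nonneg (mul_nonneg hd hPDo3) hdL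
  have hDF : 0 ≤ prob (Function.update p e 0) (avoidAll ends a₂ {a₁}) * (prob (Function.update p e 1) (avoidAll ends a₂ {a₁} ∩ connEvent ends a₁ b) - prob (Function.update p e 1) (avoidAll ends a₂ {a₁} ∩ connEvent ends a₂ b)) - prob (Function.update p e 1) (avoidAll ends a₂ {a₁}) * (prob (Function.update p e 0) (avoidAll ends a₂ {a₁} ∩ connEvent ends a₁ b) - prob (Function.update p e 0) (avoidAll ends a₂ {a₁} ∩ connEvent ends a₂ b)) := by
    rw [df_eq_root p hends a₂ b]
    exact add_nonneg (add_nonneg h1 h2) (mul_nonneg hQ0 hPDb3)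
  have hDLT : 0 ≤ prob (Function.update p e 0) (PDEvent ends a₁ a₂ a₃ ∩ connEvent ends a₁ o) * prob (Function.update p e 0) (TEvent ends a₁ a₂ a₃) - prob (Function.update p e 0) (PDEvent ends a₁ a₂ a₃) * prob (Function.update p e 0) (TEvent ends a₁ a₂ a₃ ∩ connEvent ends a₁ o) := by linarith [hoLT]
  have hPA : 0 ≤ prob (Function.update p e 0) (avoidAll ends a₂ {a₁}) * (prob (Function.update p e 0) (PDEvent ends a₁ a₂ a₃) * prob (Function.update p e 0) (PDEvent ends a₁ a₂ a₃ ∩ connEvent ends a₃ o) + (prob (Function.update p e 0) (PDEvent ends a₁ a₂ a₃) * prob (Function.update p e 0) (TEvent ends a₂ a₁ a₃ ∩ connEvent ends a₁ o) - prob (Function.update p e 0) (PDEvent ends a₁ a₂ a₃ ∩ connEvent ends a₁ o) * prob (Function.update p e 0) (TEvent ends a₂ a₁ a₃))) * (2 * ((prob (Function.update p e 0) (TEvent ends a₁ a₂ a₃ ∩ connEvent ends a₂ b) * (prob (Function.update p e 0) (PDEvent ends a₁ a₂ a₃) + prob (Function.update p e 0) (TEvent ends a₂ a₁ a₃)) -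 prob (Function.update p e 0) (TEvent ends a₁ a₂ a₃) * (prob (Function.update p e 0) (PDEvent ends a₁ a₂ a₃ ∩ connEvent ends a₂ b) + prob (Function.update p e 0) (TEvent ends a₂ a₁ a₃ ∩ connEvent ends a₂ b))) + (prob (Function.update p e 0) (TEvent ends a₁ a₂ a₃) * (prob (Function.update p e 0) (PDEvent ends a₁ a₂ a₃ ∩ connEvent ends a₁ b) + prob (Function.update p e 0) (TEvent ends a₂ a₁ a₃ ∩ connEvent ends a₁ b)) - prob (Function.update p e 0) (TEvent ends a₁ a₂ a₃ ∩ connEvent ends a₁ b) * (prob (Function.update p e 0) (PDEvent ends a₁ a₂ a₃) + prob (Function.update p e 0) (TEvent ends a₂ a₁ a₃))) + (prob (Function.update p e 0) (TEvent ends a₂ a₁ a₃) * prob (Function.update p e 0) (PDEvent ends a₁ a₂ a₃ ∩ connEvent ends a₂ b) - prob (Function.update p e 0) (PDEvent ends a₁ a₂ a₃) * prob (Function.update p e 0) (TEvent ends a₂ a₁ a₃ ∩ connEvent ends a₂ b)) + (prob (Function.update p e 0) (TEvent ends a₁ a₂ a₃) * prob (Function.update p e 0) (PDEvent ends a₁ a₂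 a₃ ∩ connEvent ends a₃ b)))) := mul_nonneg (mul_nonneg hQ0 hA) hslm
  have hPF : 0 ≤ 2 * prob (Function.update p e 1) (avoidAll ends a₂ {a₁}) * (prob (Function.update p e 0) (avoidAll ends a₂ {a₁}) * (prob (Function.update p e 1) (avoidAll ends a₂ {a₁} ∩ connEvent ends a₁ b) - prob (Function.update p e 1) (avoidAll ends a₂ {a₁} ∩ connEvent ends a₂ b)) - prob (Function.update p e 1) (avoidAll ends a₂ {a₁}) * (prob (Function.update p e 0) (avoidAll ends a₂ {a₁} ∩ connEvent ends a₁ b) - prob (Function.update p e 0) (avoidAll ends a₂ {a₁} ∩ connEvent ends a₂ b))) * (prob (Function.update p e 0) (PDEvent ends a₁ a₂ a₃ ∩ connEvent ends a₁ o) * prob (Function.update p e 0) (TEvent ends a₁ a₂ a₃) - prob (Function.update p e 0) (PDEvent ends a₁ a₂ a₃) * prob (Function.update p e 0) (TEvent ends a₁ a₂ a₃ ∩ connEvent ends a₁ o)) :=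
    mul_nonneg (mul_nonneg (mul_nonneg zero_le_two hQ1) hDF) hDLT
  exact add_nonneg hPA hPF

/-- **`0 ≤ H2` at a root edge from (W) alone**: if the product term is at most the closed-pin kernel,
`NEG ≤ Q₁²·Gc₀`, and `0 < Q₀`, then `0 ≤ H2` (through `H2_nonneg_root_of_signed`, the payers being non-negative).
The hypothesis (W) is a single-instance statement at the closed pin; no sign claimed. -/
theorem H2_nonneg_root_of_kernel_dominates (p : E → R) (hp : IsProbVec p) (hends : ends e = s(a₁, a₃))
    (o a₂ b : V) (hQ : 0 < prob (Function.update p e 0) (avoidAll ends a₂ {a₁}))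
    (hW : 2 * (prob (Function.update p e 0) (PDEvent ends a₁ a₂ a₃ ∩ connEvent ends a₂ o) * prob (Function.update p e 0) (TEvent ends a₂ a₁ a₃) - prob (Function.update p e 0) (PDEvent ends a₁ a₂ a₃) * prob (Function.update p e 0) (TEvent ends a₂ a₁ a₃ ∩ connEvent ends a₂ o)) * (prob (Function.update p e 0) (avoidAll ends a₂ {a₁}) * (prob (Function.update p e 0) (TEvent ends a₂ a₁ a₃) * prob (Function.update p e 0) (PDEvent ends a₁ a₂ a₃ ∩ connEvent ends a₂ b) - prob (Function.update p e 0) (PDEvent ends a₁ a₂ a₃) * prob (Function.update p e 0) (TEvent ends a₂ a₁ a₃ ∩ connEvent ends a₂ b)) + prob (Function.update p e 1) (avoidAll ends a₂ {a₁}) * ((prob (Function.update p e 0) (TEvent ends a₁ a₂ a₃ ∩ connEvent ends a₂ b) * (prob (Function.update p e 0) (PDEvent ends a₁ a₂ a₃) + prob (Function.update p e 0) (TEvent ends a₂ a₁ a₃)) - prob (Function.update p e 0) (TEvent ends a₁ a₂ a₃) * (prob (Function.update p e 0) (PDEvent ends a₁ a₂ a₃ ∩ connEvent ends a₂ b) +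 prob (Function.update p e 0) (TEvent ends a₂ a₁ a₃ ∩ connEvent ends a₂ b))) + (prob (Function.update p e 0) (TEvent ends a₁ a₂ a₃) * (prob (Function.update p e 0) (PDEvent ends a₁ a₂ a₃ ∩ connEvent ends a₁ b) + prob (Function.update p e 0) (TEvent ends a₂ a₁ a₃ ∩ connEvent ends a₁ b)) - prob (Function.update p e 0) (TEvent ends a₁ a₂ a₃ ∩ connEvent ends a₁ b) * (prob (Function.update p e 0) (PDEvent ends a₁ a₂ a₃) + prob (Function.update p e 0) (TEvent ends a₂ a₁ a₃))))) ≤ prob (Function.update p e 1) (avoidAll ends a₂ {a₁}) ^ 2 * Gc (Function.update p e 0) ends o a₁ a₂ a₃ b) :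
    0 ≤ H2 p ends o a₁ a₂ a₃ b e := by
  refine H2_nonneg_root_of_signed p hp hends o a₂ b hQ ?_
  have hpay := payers_nonneg_root p hp hends o a₂ b
  linarith [hW, hpay]

end KernelDominates

end QuarticRootCross

end Summit.Ventures.PercRepro2

/-!
## CORRECTION (p5 g20, 2026-08-28T01:3xZ, within the hour of the landing): the hypothesis (W) is FALSE in general

The module docstring calls (W) a «census-true candidate». The engine seat (STATUS 9140, two engine codes) found it false on
135 of the 2,324 a₁-side K-monotonicity witness lines of kit j294340 that carry the root edge and on 2 of 15,000 random
root-edge lines; re-derived here by an independent direct enumeration (`mining/p5/g20/probe/wwitness.py`, exact rationals):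
`n = 7`, edges `(0,2) (1,2) (1,3) (2,4) (3,5) (3,6) (4,5) (4,6) (5,6)`, weights
`4095/4096, 4093/4096, 2047/2048, 4095/4096, 4093/4096, 1/4096, 1/4096, 4095/4096, 2047/2048`, marks
`(o, a₁, a₂, a₃, b) = (4, 5, 2, 6, 3)`, root edge `(5,6)`: at the closed pin `Q₁ = D₀ + t′ ≈ D₀` (`t′` tiny),
`Q₁²·Gc₀ = 4.49·10⁻³⁵ < NEG = 5.61·10⁻³⁵` — `(Q₁²Gc₀ − NEG)/NEG = −0.199248`, the engine's digits. The face itself is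
`≥ 0` there (the payers `Q₀·A·slackBm + 2Q₁·df·δ_oL^T` cover the rest), and `(W4)` held on all of the engine's
17,326 lines. So the kernel at the closed pin does NOT always cover the product term by itself: the A/df payers are
load-bearing (as p5 g19's RX census already said at 152 / 7.8 M lines — «NEG > rest» there; here it is the dual
«NEG > kernel»). `H2_nonneg_root_of_kernel_dominates` stays a correct conditional reduction; it is not a proof route.
The violations live where `Q₁ ≈ D₀` (`P₀(T′)` tiny) at near-boundary weights.
-/
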